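import Summits.RiemannHypothesis.RiemannHypothesis.Theorems.SoloInformedMarkovMargin

/-!
# The bound-state count behind RH is decided at a doubly exponentially small margin

Solo programme `solo-RiemannHypothesis-informed`, session 17 (pieces in
`SoloInformedMarkovMargin.lean`; notation as in `SoloInformedMarkovBoundState.lean`).
Everything here is proved, with no hypothesis on the zeros.

By `riemannHypothesis_iff_markovIndex_le_one` RH holds iff in every plane `span(g, h)` of test
functions some `v ≠ 0` has `Q₀(v) ≥ 0`, `Q₀ = weilMarkovQuadratic` the pole-removed (Markov)
part of `Re W(v ⋆ ṽ)`; on a window `[-a, a]`: the jump form `𝓔_a` has at most one eigenvalue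
below `M_a` (`riemannHypothesis_iff_atMostOneBoundState`). The theorem
`exists_plane_weilMarkovQuadratic_le` of this file shows that this count is decided at a doubly
exponentially small spectral margin: there are absolute `c > 0`, `C` such that for all large `a`
the window `[-a, a]` carries a genuine plane `V = span(w, e)` of test functions with

  `Q₀(v) ≤ C exp(-c e^{2a}) ‖v‖₂²`  for every `v ∈ V`.

RH asserts `sup_{v ∈ V ∖ 0} Q₀(v)/‖v‖₂² ≥ 0` on every plane; unconditionally there are planes on
which it is `≤ C exp(-c e^{2a})`: the second eigenvalue of `𝓔_a` lies within `C exp(-c e^{2a})`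
of the threshold, and RH is exactly the statement about its side.

Construction: `w` = the pole-free near-null vector of `exists_poleFree_nearNull` at
`λ = e^{a - s₀} − 1` (so that it lives on `|x| ≤ a − 2r − 1`), `e = u(· − b) + u(· + b)` two
bumps at `b = a − r` (`u` supported in `[-r, r]`, `s₀ = 2r + 3`). Then `w · e ≡ 0`,
`P(αw + βe) = |β|² P(e)`, the cross sums are `O(2^{-M(λ)} e^{b/2})` (`norm_cross_le`), the
two-bump inequality `‖Q(e)‖ + û(0)û(1) e^{b} ≤ P(e)` absorbs them
(`weilMarkovQuadratic_plane_le`), and `4^{-M(λ)} ≤ exp(-c e^{2a})` (`half_pow_decayM_sq_le`).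

References: E. Bombieri, Rend. Mat. Acc. Lincei (9) 11 (2000) 183–233, Thm 2; H. Yoshida,
Adv. Stud. Pure Math. 21 (1992) 281–325, §6. The result is new.
-/

noncomputable section

open Complex Filter Set MeasureTheory
open scoped Real Topology ComplexConjugate

namespace Summit.RiemannHypothesis.RiemannHypothesis.Theorems

open Literature.NumberTheory.LFunctions Literature.NumberTheory.LFunctions.WeilConverse
  Literature.NumberTheory.LFunctions.WeilContinuous

/-- The rate bookkeeping: for `a ≥ s₀ + 1` and `λ = e^{a − s₀} − 1`,
`4^{-(M(λ)+1)} ≤ exp(-c e^{2a})` with `c = (log 2/(4X₀))/(4 e^{2s₀})`. [new] -/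
theorem half_pow_decayM_sq_le {s₀ a : ℝ} (ha : s₀ + 1 ≤ a) :
    ((1 / 2 : ℝ) ^ (decayM (Real.exp (a - s₀) - 1) + 1)) ^ 2 ≤
      Real.exp (-(Real.log 2 / (4 * fdX) / (4 * Real.exp (2 * s₀))) * Real.exp (2 * a)) := by
  set lam : ℝ := Real.exp (a - s₀) - 1 with hlamdef
  set κ : ℝ := Real.log 2 / (4 * fdX) with hκ
  have hκ0 : 0 < κ := div_pos (Real.log_pos one_lt_two) (by linarith [fdX_pos])
  have hq0 : 0 ≤ (1 / 2 : ℝ) ^ (decayM lam + 1) := by positivity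
  have h1 : ((1 / 2 : ℝ) ^ (decayM lam + 1)) ^ 2 ≤ Real.exp (-κ * lam ^ 2) :=
    calc ((1 / 2 : ℝ) ^ (decayM lam + 1)) ^ 2 ≤ ((1 / 2 : ℝ) ^ (decayM lam + 1)) ^ 1 :=
          pow_le_pow_of_le_one hq0 (half_pow_le_one (decayM lam)) one_le_two
      _ = _ := pow_one _
      _ ≤ _ := half_pow_decayM_le lam
  refine h1.trans (Real.exp_le_exp.2 ?_)
  have hexp2 : 2 ≤ Real.exp (a - s₀) := by
    have : Real.exp 1 ≤ Real.exp (a - s₀) := Real.exp_le_exp.2 (by linarith)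
    linarith [Real.add_one_le_exp (1 : ℝ)]
  have hhalf : Real.exp (a - s₀) / 2 ≤ lam := by rw [hlamdef]; linarith
  have hsq : Real.exp (2 * a) / (4 * Real.exp (2 * s₀)) ≤ lam ^ 2 := by
    have h3 : (Real.exp (a - s₀) / 2) ^ 2 ≤ lam ^ 2 := pow_le_pow_left₀ (by positivity) hhalf 2
    have h4 : (Real.exp (a - s₀) / 2) ^ 2 = Real.exp (2 * a) / (4 * Real.exp (2 * s₀)) := by
      rw [div_pow, sq, ← Real.exp_add, show a - s₀ + (a - s₀) = 2 * a - 2 * s₀ by ring,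
        Real.exp_sub, div_div, show Real.exp (2 * s₀) * (2 : ℝ) ^ 2 = 4 * Real.exp (2 * s₀) by
          ring]
    linarith
  have : κ / (4 * Real.exp (2 * s₀)) * Real.exp (2 * a) =
      κ * (Real.exp (2 * a) / (4 * Real.exp (2 * s₀))) := by ring
  rw [neg_mul, neg_mul, this, neg_le_neg_iff]
  exact mul_le_mul_of_nonneg_left hsq hκ0.le

/-- Two bumps `u(· − b) + u(· + b)`, `u` vanishing off `[-r, r]`, `b ≥ 0`: the pair vanishes
where `|t| < b − r` and is supported in `[-(b + r), b + r]`. [folklore] -/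
theorem twoBump_support {u : ℝ → ℂ} {r b : ℝ} (hur : ∀ x : ℝ, r < |x| → u x = 0)
    (hb0 : 0 ≤ b) :
    (∀ t : ℝ, |t| < b - r → (weilTranslate u b + weilTranslate u (-b)) t = 0) ∧
      tsupport (weilTranslate u b + weilTranslate u (-b)) ⊆ Icc (-(b + r)) (b + r) := by
  have he_apply : ∀ t, (weilTranslate u b + weilTranslate u (-b)) t = u (t - b) + u (t - -b) :=
    fun t ↦ rfl
  refine ⟨fun t ht ↦ ?_, closure_minimal (fun t ht ↦ ?_) isClosed_Icc⟩
  · rw [he_apply, hur (t - b) (lt_abs.2 (Or.inr (by linarith [le_abs_self t]))),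
      hur (t - -b) (lt_abs.2 (Or.inl (by linarith [neg_abs_le t]))), add_zero]
  · by_contra habs
    have hta : b + r < |t| := by
      by_contra hle
      push Not at hle
      exact habs ⟨by linarith [neg_abs_le t], by linarith [le_abs_self t]⟩
    refine ht ?_
    have h1 := abs_sub_abs_le_abs_sub t b
    have h2 := abs_sub_abs_le_abs_sub t (-b)
    rw [abs_of_nonneg hb0] at h1
    rw [abs_neg, abs_of_nonneg hb0] at h2
    rw [he_apply, hur (t - b) (by linarith), hur (t - -b) (by linarith), add_zero]

/-- The two-bump transform on the closed strip: `|ê(s)| ≤ 2 e^{b/2} D_u/(1 + (Im s)²)`.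
[folklore] -/
theorem norm_weilMellin_twoBump_le {u : ℝ → ℂ} (hu : IsWeilTest u) {b : ℝ} (hb0 : 0 ≤ b) {s : ℂ}
    (h0 : 0 ≤ s.re) (h1 : s.re ≤ 1) :
    ‖weilMellin (weilTranslate u b + weilTranslate u (-b)) s‖ ≤
      2 * Real.exp (b / 2) * (weilDecayConst u / (1 + s.im ^ 2)) := by
  rw [weilMellin_twoBump hu, norm_mul]
  have hD : 0 ≤ weilDecayConst u := weilDecayConst_nonneg _
  refine mul_le_mul ((norm_twoExp_le s hb0).trans ?_) (norm_weilMellin_le hu h0 h1)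
    (norm_nonneg _) (by positivity)
  refine mul_le_mul_of_nonneg_left (Real.exp_le_exp.2 ?_) zero_le_two
  have : |s.re - 1 / 2| ≤ 1 / 2 := abs_le.2 ⟨by linarith, by linarith⟩
  nlinarith

/-- The cross sums of the polarisation: if `|ŵ(ρ)| ≤ A/(1+γ²)` at the zeros and
`|ê(s)| ≤ B/(1+(Im s)²)` on the closed strip, both cross sums are at most `A B ∑_ρ m(ρ)/(1+γ²)²`
in norm (the reflected points `1 − ρ̄` are again zeros). [folklore] -/
theorem norm_cross_le {w e : ℝ → ℂ} {A B : ℝ} (hA : 0 ≤ A)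
    (hw : ∀ ρ ∈ ZetaZeros.riemannZetaNontrivialZeros, ‖weilMellin w ρ‖ ≤ A / (1 + ρ.im ^ 2))
    (he : ∀ s : ℂ, 0 ≤ s.re → s.re ≤ 1 → ‖weilMellin e s‖ ≤ B / (1 + s.im ^ 2)) :
    ‖∑' ρ : ZetaZeros.riemannZetaNontrivialZeros, (riemannZetaZeroOrder (ρ : ℂ) : ℂ) *
        (weilMellin w ρ * conj (weilMellin e (1 - conj (ρ : ℂ))))‖ ≤
      A * B * ∑' ρ : ZetaZeros.riemannZetaNontrivialZeros, weilZeroWeight (ρ : ℂ) ∧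
    ‖∑' ρ : ZetaZeros.riemannZetaNontrivialZeros, (riemannZetaZeroOrder (ρ : ℂ) : ℂ) *
        (weilMellin e ρ * conj (weilMellin w (1 - conj (ρ : ℂ))))‖ ≤
      A * B * ∑' ρ : ZetaZeros.riemannZetaNontrivialZeros, weilZeroWeight (ρ : ℂ) := by
  constructor
  · refine norm_zeroTsum_le (f := fun s ↦ weilMellin w s * conj (weilMellin e (1 - conj s)))
      fun ρ hρ ↦ ?_
    obtain ⟨-, hre, hre1⟩ := mem_riemannZetaNontrivialZeros_iff_holds.1 hρ
    have h2 := he (1 - conj ρ) (by rw [one_sub_conj_re]; linarith)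
      (by rw [one_sub_conj_re]; linarith)
    rw [one_sub_conj_im] at h2
    have hpos : 0 < 1 + ρ.im ^ 2 := by positivity
    rw [norm_mul, Complex.norm_conj]
    calc ‖weilMellin w ρ‖ * ‖weilMellin e (1 - conj ρ)‖
        ≤ A / (1 + ρ.im ^ 2) * (B / (1 + ρ.im ^ 2)) :=
          mul_le_mul (hw ρ hρ) h2 (norm_nonneg _) (by positivity)
      _ = A * B / (1 + ρ.im ^ 2) ^ 2 := by field_simp
  · refine norm_zeroTsum_le (f := fun s ↦ weilMellin e s * conj (weilMellin w (1 - conj s)))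
      fun ρ hρ ↦ ?_
    obtain ⟨-, hre, hre1⟩ := mem_riemannZetaNontrivialZeros_iff_holds.1 hρ
    have h1 := hw (1 - conj ρ) (ZetaZeros.riemannZetaNontrivialZeros.one_sub_conj_mem hρ)
    rw [one_sub_conj_im] at h1
    have h2 := he ρ hre.le hre1.le
    have hpos : 0 < 1 + ρ.im ^ 2 := by positivity
    rw [norm_mul, Complex.norm_conj]
    calc ‖weilMellin e ρ‖ * ‖weilMellin w (1 - conj ρ)‖
        ≤ B / (1 + ρ.im ^ 2) * (A / (1 + ρ.im ^ 2)) :=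
          mul_le_mul h2 h1 (norm_nonneg _) ((norm_nonneg _).trans h2)
      _ = A * B / (1 + ρ.im ^ 2) ^ 2 := by field_simp

set_option maxHeartbeats 400000 in
/-- **THE MARGIN OF THE BOUND-STATE COUNT** (claim C150 of the solo programme; unconditional).
There are absolute `c > 0`, `C`, `a₁` such that for every `a ≥ a₁` the window `[-a, a]` carries
test functions `w, e` with `w · e ≡ 0`, `‖w‖₂ > 0` and `Q₀(e) < 0` — so `V = span(w, e)` is a
genuine plane of window tests — on which

  `Q₀(α w + β e) ≤ C exp(-c e^{2a}) ‖α w + β e‖₂²`  for all `α, β ∈ ℂ`.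

By `riemannHypothesis_iff_markovIndex_le_one`, RH says `sup_{v ∈ V ∖ 0} Q₀(v) ≥ 0` on every
such plane; unconditionally planes exist where this supremum is `≤ C exp(-c e^{2a}) ‖v‖₂²`:
the "at most one bound state" count of `riemannHypothesis_iff_atMostOneBoundState` is decided,
window by window, at a doubly exponentially small spectral margin. [new] -/
theorem exists_plane_weilMarkovQuadratic_le :
    ∃ c : ℝ, 0 < c ∧ ∃ C a₁ : ℝ, ∀ a : ℝ, a₁ ≤ a → ∃ w e : ℝ → ℂ,
      IsWeilTest w ∧ IsWeilTest e ∧ tsupport w ⊆ Icc (-a) a ∧ tsupport e ⊆ Icc (-a) a ∧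
      (∀ t, w t = 0 ∨ e t = 0) ∧ 0 < ∫ t, ‖w t‖ ^ 2 ∧ weilMarkovQuadratic e < 0 ∧
      ∀ α β : ℂ, weilMarkovQuadratic (fun t ↦ α * w t + β * e t) ≤
        C * Real.exp (-c * Real.exp (2 * a)) * ∫ t, ‖α * w t + β * e t‖ ^ 2 := by
  obtain ⟨u, hu, I₀, I₁, hI₀, hI₁, hu0, hu1⟩ := exists_isWeilTest_weilMellin_zero_one_pos
  obtain ⟨r, hr0, hur⟩ : ∃ r : ℝ, 0 < r ∧ ∀ x : ℝ, r < |x| → u x = 0 := by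
    obtain ⟨r₀, hr₀⟩ := hu.2.isCompact.isBounded.subset_closedBall (0 : ℝ)
    refine ⟨max r₀ 1, by positivity, fun x hx ↦ image_eq_zero_of_notMem_tsupport fun h ↦ ?_⟩
    have h1 : |x| ≤ r₀ := by simpa [Real.dist_eq] using Metric.mem_closedBall.1 (hr₀ h)
    linarith [le_max_left r₀ 1]
  obtain ⟨b₀, hb₀, hB⟩ := exists_twoBump_threshold hu hI₀ hI₁ hu0 hu1
  obtain ⟨ε, n, lam₁, hε, hn, hlam₁, hfam⟩ := exists_poleFree_nearNull
  have hDu0 : 0 ≤ weilDecayConst u := weilDecayConst_nonneg _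
  have hW0 : 0 ≤ ∑' ρ : ZetaZeros.riemannZetaNontrivialZeros, weilZeroWeight (ρ : ℂ) :=
    tsum_weilZeroWeight_nonneg
  set W : ℝ := ∑' ρ : ZetaZeros.riemannZetaNontrivialZeros, weilZeroWeight (ρ : ℂ) with hW
  set K₁ : ℝ := ε ^ 2 * W + (2 * ε * weilDecayConst u * W) ^ 2 / (I₀ * I₁) with hK₁
  have hK₁0 : 0 ≤ K₁ := by rw [hK₁]; positivity
  -- bookkeeping: `a = log(λ + 1) + s₀`, `s₀ = 2r + 3`
  set s₀ : ℝ := 2 * r + 3 with hs₀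
  set c : ℝ := Real.log 2 / (4 * fdX) / (4 * Real.exp (2 * s₀)) with hc
  have hc0 : 0 < c :=
    div_pos (div_pos (Real.log_pos one_lt_two) (by linarith [fdX_pos])) (by positivity)
  refine ⟨c, hc0, K₁ / n, max (max (Real.log (lam₁ + 1) + s₀) (b₀ + r)) (s₀ + 1), fun a ha ↦ ?_⟩
  have ha1 : Real.log (lam₁ + 1) + s₀ ≤ a := ((le_max_left _ _).trans (le_max_left _ _)).trans ha
  have ha2 : b₀ + r ≤ a := ((le_max_right _ _).trans (le_max_left _ _)).trans ha
  have ha3 : s₀ + 1 ≤ a := (le_max_right _ _).trans ha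
  set lam : ℝ := Real.exp (a - s₀) - 1 with hlamdef
  have hlamge : lam₁ ≤ lam := by
    have h2 : Real.exp (Real.log (lam₁ + 1)) ≤ Real.exp (a - s₀) :=
      Real.exp_le_exp.2 (by linarith)
    rw [Real.exp_log (by linarith)] at h2
    rw [hlamdef]
    linarith
  have hrad : decayRadius lam + 1 = a - 2 * r - 1 := by
    unfold decayRadius
    rw [hlamdef, sub_add_cancel, Real.log_exp, hs₀]
    ring
  obtain ⟨w, hw, hw0, hw1, hwz, hwρ, hwn⟩ := hfam lam hlamge
  rw [hrad] at hwz
  set q : ℝ := (1 / 2 : ℝ) ^ (decayM lam + 1) with hq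
  have hq0 : 0 ≤ q := by rw [hq]; positivity
  -- the two bumps at `±b`, `b = a - r`
  set b : ℝ := a - r with hb
  have hbb : b₀ ≤ b := by rw [hb]; linarith
  have hb0 : 0 ≤ b := hb₀.trans hbb
  set e : ℝ → ℂ := weilTranslate u b + weilTranslate u (-b) with hedef
  have he : IsWeilTest e := (hu.weilTranslate b).add (hu.weilTranslate (-b))
  obtain ⟨hez, hes⟩ := twoBump_support hur hb0
  have hd : ∀ t, w t = 0 ∨ e t = 0 := fun t ↦ by
    rcases lt_or_ge (a - 2 * r - 1) |t| with ht | ht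
    · exact Or.inl (hwz t ht)
    · exact Or.inr (hez t (by rw [hb]; linarith))
  have hws : tsupport w ⊆ Icc (-a) a := by
    refine closure_minimal (fun t ht ↦ ?_) isClosed_Icc
    by_contra habs
    refine ht (hwz t ?_)
    by_contra hle
    push Not at hle
    exact habs ⟨by linarith [neg_abs_le t], by linarith [le_abs_self t]⟩
  have hes' : tsupport e ⊆ Icc (-a) a :=
    hes.trans (Icc_subset_Icc (by rw [hb]; linarith) (by rw [hb]; linarith))
  -- `Re Q(w)` and the cross sums
  have hZ : (zeroForm w).re ≤ (ε * q) ^ 2 * W := by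
    rw [combShapeDetection_zeroForm_eq_weilQuadratic hw]
    refine re_weilQuadratic_le_of_zeroSum_le hw
      (zeroSum_le_of_norm_sq_le (A := (ε * q) ^ 2) (by positivity) fun ρ hρ ↦ ?_)
    have hpos : 0 < 1 + ρ.im ^ 2 := by positivity
    calc ‖weilMellin w ρ‖ ^ 2 ≤ (ε * q / (1 + ρ.im ^ 2)) ^ 2 :=
          pow_le_pow_left₀ (norm_nonneg _) (hwρ ρ hρ) 2
      _ = (ε * q) ^ 2 / (1 + ρ.im ^ 2) ^ 2 := by rw [div_pow]
  obtain ⟨hX, hY⟩ := norm_cross_le (B := 2 * Real.exp (b / 2) * weilDecayConst u)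
    (mul_nonneg hε hq0) hwρ fun s h0 h1 ↦ (norm_weilMellin_twoBump_le hu hb0 h0 h1).trans_eq
      (by ring)
  -- the two bumps
  have hexpb : Real.exp (b / 2) ^ 2 = Real.exp b := by rw [sq, ← Real.exp_add, add_halves]
  have hPe : ‖zeroForm e‖ + I₀ * I₁ * Real.exp (b / 2) ^ 2 ≤ weilPoleForm e := by
    rw [hexpb]
    exact hB b hbb
  -- on the plane
  have hid : (ε * q) ^ 2 * W + (ε * q * (2 * Real.exp (b / 2) * weilDecayConst u) * W) ^ 2 /
      (I₀ * I₁ * Real.exp (b / 2) ^ 2) = q ^ 2 * K₁ := by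
    rw [hK₁]
    field_simp
  have hplane : ∀ α β : ℂ,
      weilMarkovQuadratic (fun t ↦ α * w t + β * e t) ≤ ‖α‖ ^ 2 * (q ^ 2 * K₁) := fun α β ↦ by
    rw [← hid]
    exact weilMarkovQuadratic_plane_le hw he hw0 hw1 hZ hX hY (by positivity) hPe α β
  have hnorm : ∀ α β : ℂ, ‖α‖ ^ 2 * n ≤ ∫ t, ‖α * w t + β * e t‖ ^ 2 := fun α β ↦ by
    rw [integral_norm_sq_lin_of_disjoint hw he hd]
    have : 0 ≤ ‖β‖ ^ 2 * ∫ t, ‖e t‖ ^ 2 :=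
      mul_nonneg (sq_nonneg _) (integral_nonneg fun t ↦ by positivity)
    nlinarith [mul_le_mul_of_nonneg_left hwn (sq_nonneg ‖α‖)]
  have hqexp : q ^ 2 ≤ Real.exp (-c * Real.exp (2 * a)) := half_pow_decayM_sq_le ha3
  have hKn : K₁ = K₁ / n * n := (div_mul_cancel₀ K₁ hn.ne').symm
  refine ⟨w, e, hw, he, hws, hes', hd, lt_of_lt_of_le hn hwn, ?_, fun α β ↦ ?_⟩
  · -- `Q₀(e) < 0`
    have hcomb : (weilQuadratic e).re = (zeroForm e).re := by
      rw [combShapeDetection_zeroForm_eq_weilQuadratic he]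
    rw [weilMarkovQuadratic, hcomb]
    have := Complex.re_le_norm (zeroForm e)
    nlinarith [mul_pos (mul_pos hI₀ hI₁) (pow_pos (Real.exp_pos (b / 2)) 2)]
  · calc weilMarkovQuadratic (fun t ↦ α * w t + β * e t) ≤ ‖α‖ ^ 2 * (q ^ 2 * K₁) := hplane α β
      _ ≤ ‖α‖ ^ 2 * (Real.exp (-c * Real.exp (2 * a)) * K₁) :=
          mul_le_mul_of_nonneg_left (mul_le_mul_of_nonneg_right hqexp hK₁0) (sq_nonneg _)
      _ = K₁ / n * Real.exp (-c * Real.exp (2 * a)) * (‖α‖ ^ 2 * n) := by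
          conv_lhs => rw [hKn]
          ring
      _ ≤ K₁ / n * Real.exp (-c * Real.exp (2 * a)) * ∫ t, ‖α * w t + β * e t‖ ^ 2 :=
          mul_le_mul_of_nonneg_left (hnorm α β)
            (mul_nonneg (div_nonneg hK₁0 hn.le) (Real.exp_pos _).le)

end Summit.RiemannHypothesis.RiemannHypothesis.Theorems
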